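import Summits.QuantumFields.BalabanUV.T4Continuum.Spine.NE1p.DressedSmallFieldOnCoresMass
import Summits.QuantumFields.BalabanUV.T4Continuum.Support.SubstrateActivities

/-!
# T⁴ programme, spine estimate NE1′ (node O3b/H2) — THE CORES' ENDs HOST THE SUBSTRATE'S ACTIVITY SLOT OF RECORD: N0p's
# (B1)-discharged induction END re-run for core families whose polymer-family types VARY WITH THE TERM (`dom k i`), so that the
# substrate's `SubstrateActivities.actOfLetters ℓ Z j o h = (coreOf ℓ Z j).termAt o h` IS such a family BY `rfl` — the attached
# part of `E[Σ_j actOfLetters ℓ Z j o (h₀ + w)] − E[Σ_j actOfLetters ℓ Z j o h₀]` bounded with NO `hact` binder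

Cell `pub-balaban`, sub-cell `t4`, BINDER-OWNERS row NE1′; owner lineage t4-ne1p-p1 (PROVER seat P1, «RG-trajectory comparison …
μ-uniformity through the printed small-field bounds»), generation 28; ADDITIVE — imports the owner's N0q
`Spine/NE1p/DressedSmallFieldOnCoresMass` (→ N0p p224732) and the SUBSTRATE cell's `Support/SubstrateActivities` (p219669,
substrate-p1; → row NE5's `B13TermContourCore` ∕ `B13TermCoreFamily`) ONLY; THEOREMS ONLY (0 def, 0 `def … : Prop`, 0 cite);
nothing of N0p ∕ N0q ∕ row NE5's ∕ the substrate's modules is restated — their declarations are used BY NAME (cross-row BY NAME as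
in N0p; the substrate's letters are the SUBSTRATE cell's objects, MAP §O1 O-3 `act`).

WHY THIS FILE (HANDOFF gen 27 → 28 item (5)(a) «(B1b) by name: instantiate N0p §4 at the cores of record»; N0p's own docstring: «the
substrate's activity slot … becomes a `termBi` family once the substrate's `slotsOfRecord` fixes its polymer ∕ parameter types»).
The obstacle was a TYPE, not a fact: N0p §4's family `𝔊 k i X : BiCore P dom Op (β k i) (α k i)` has ONE polymer-family type `𝒴`
with ONE `dom : 𝒴 → C.Dom` for all terms, whereas the substrate's cores `coreOf ℓ Z j : BiCore P (dom Z j) Op ((Jc Z j ⊕ 𝒴 Z j) →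
ℝ × ℝ) (V Z j)` carry a polymer-family type `𝒴 Z j` PER FACTOR.  Row NE5's two structural theorems (`termGaussianParamBi_termBi`,
`termHistExpLinear_of_bi`) never use the constancy of `dom`; so:
* §1 (kernel, row NE5's proof VERBATIM for dependent `dom k i`) `termGaussianParamBi_termAt` ∕ `termHistExpLinear_termAt` — for
  `𝔊 k i X : BiCore P (dom k i) Op (β k i) (α k i)` with operator letters `hm`∕`hN`∕`hq` at the class centres and a room, the term
  family `fun k i o h X => (𝔊 k i X).termAt o h` satisfies `TermGaussianParamBi` (representation clause by `rfl`) and hence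
  `TermHistExpLinear` on the ball class.
* §2 (kernel) `attachedPart_locE_le_of_coresAt_pencil_mass` — N0p §3's `attachedPart_locE_le_of_expLinear` along the linear table
  pencil `h₀ + s • w` for such families, read-out bounds by the cores' `N₁`, and (B3) as N0q's LETTER budget `hM3` (N0q §1's
  `norm_integral_coreDensity_le` termwise) — i.e. N0q's `attachedPart_locE_le_of_cores_pencil_mass` for term-dependent `dom`.
* §2∕§3 twins for the SOURCE pencil `h₀ + s • v` (the observable's table contribution `v` scaled by the source, `‖s‖ < μ₁`):
  `muPart_locE_le_of_coresAt_pencil_mass` ∕ **`muPart_locE_le_of_actOfLetters`** (N0p §3's `muPart_locE_le_of_expLinear`).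
* §3 (kernel) **`attachedPart_locE_le_of_actOfLetters`** — §2 AT THE SUBSTRATE'S LETTERS `ℓ : ∀ Z j, CoreLetters P Op 𝒴 dom Jc V Z j`:
  term index `Pol × J`, `𝔊 k p X := coreOf ℓ p.1 p.2`, dressed activity of the `locE` polymer `Z` := `Σ_{p ∈ terms Z} actOfLetters ℓ
  p.1 p.2 o (h₀ + s • w)` — `hact` holds BY `rfl` (`actOfLetters_apply`) and is NO LONGER A BINDER; the operator letters are asked
  of the substrate's supplied Gaussian letters `(ℓ Z j).N`, `(ℓ Z j).q` (`coreOf_N` ∕ `coreOf_q`, `rfl`) on the open operator ball —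
  exactly the clauses row NE5's `B13AssemblyCoresEndSubstrateLetters` discharges into p3's `SubstrateGaussianLettersBall` lemmas
  (left DISPLAYED here); conclusion: the attached part of the dressed small-field output of the SLOT ACTIVITIES at the dressed table
  `h₀ + w` against the undressed `h₀` is `≤ 4·(e ν c₁ K₀²)·A₁·e^{−r₁ d(X₀)}`.

WHAT THIS DOES TO THE WALL (owner's reading; nothing re-labelled here).  For the substrate's activity slot of record, the INDEXING
half (B1b) of the bracket's «(B1) READING `hrep`» shrinks to what is DISPLAYED in §3: `terms : D.Dom → Finset (Pol × J)` and
`emb : D.Dom → C.Dom` with `hscale` — WHICH substrate factors `(Z′, j)` make up the `locE` polymer `Z` of the cell's geometry and at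
which carrier domain of scale `k` they sit (MAP §O1 D-5′: the observable enters through the TABLE, no new slot) — plus the class's
radius bookkeeping `hO`∕`hH`.  (B1a) is kernel (N0p); (B3) is N0q's letter budget on the substrate's cores; (B4)∕(B5) as before.
NOTHING is discharged on Bałaban's densities: the letters ARE the substrate's displayed inputs; whether they realise
[Balaban1988RGII] (2.14)'s data is the substrate's ∕ row NE5's displayed identification; wall v1.6 does NOT move; NE1′ NOT printed,
NOT proved; 0∕9; count 9 unchanged.

HONEST FRAMING.  By-name compositions over SHAPES, row NE5's PROVED structural theorems and the substrate's DATA definitions; the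
cores are the cell's typed FORMAT of (2.14) with letters, not Bałaban's functions; [Balaban1988RGII] (2.14) p. 15, (2.18) p. 16,
(2.38) p. 20 are LOCI (TYPE∕CONTEXT) quoted in the imported modules with their tags; ABSOLUTE RULE honoured.  Rung (B)+1 on ONE
finite four-torus — NOT infinite volume, NOT a mass gap, NOT OS on ℝ⁴, NOT Clay.  HONEST DEPENDENCY: continuum YM on T⁴ ⇐ BetaPertH
∧ nine spine estimates (0/9 proved); BetaPertH ⇐ (D1) ∧ (D4) ∧ CAP+tail; G-an2-4 gates asym, D1 and NE2/3/4.
-/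

noncomputable section

namespace Summit.QuantumFields.BalabanUV.T4Continuum.NE1p.DressedSmallFieldOnCoresSlot

open Metric Set Complex MeasureTheory
open scoped BigOperators
open Literature.MathematicalPhysics.QuantumFieldTheory.Balaban1983to89 (LocDomainSys)
open Literature.MathematicalPhysics.QuantumFieldTheory.Balaban1983to89.T4OutputRate (Carriers)
open Literature.MathematicalPhysics.QuantumFieldTheory.Balaban1983to89.B13Resummation (locE Geometry)
open Literature.MathematicalPhysics.QuantumFieldTheory.Balaban1983to89.T4InputCauchyRateSpecies (ballClass)
open Literature.MathematicalPhysics.QuantumFieldTheory.Balaban1983to89.T4InputCauchyRateTermwise (TermHistExpLinear)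
open Summit.QuantumFields.BalabanUV.T4Continuum.B13HistMeasurable (MeasPotFrame B13HistM)
open Summit.QuantumFields.BalabanUV.T4Continuum.B13TermParamGaussianBi (BiCore)
open Summit.QuantumFields.BalabanUV.T4Continuum.OutputRateGaussianParamBi (TermGaussianParamBi termHistExpLinear_of_bi)
open Summit.QuantumFields.BalabanUV.T4Continuum.SubstrateActivities (CoreLetters coreOf actOfLetters)
open Summit.QuantumFields.BalabanUV.T4Continuum.NE1p.DressedSmallFieldOnCores (attachedPart_locE_le_of_expLinear
  muPart_locE_le_of_expLinear pencil_mem_ballClass norm_pencil_le)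
open Summit.QuantumFields.BalabanUV.T4Continuum.NE1p.DressedSmallFieldOnCoresMass (norm_integral_coreDensity_le)

/-! ## §1 CORE FAMILIES WITH TERM-DEPENDENT POLYMER FAMILIES: row NE5's two structural theorems, proofs verbatim -/

section Dep

variable {C : Carriers} {P : MeasPotFrame C} {Op : Type*} [NormedAddCommGroup Op] [NormedSpace ℂ Op] {ι : Type*}
  {𝒴 : ℕ → ι → Type*} {dom : ∀ k i, 𝒴 k i → C.Dom} {β : ℕ → ι → Type*} [∀ k i, MeasurableSpace (β k i)]
  {α : ℕ → ι → Type*} [∀ k i, NormedAddCommGroup (α k i)] [∀ k i, InnerProductSpace ℝ (α k i)]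
  [∀ k i, FiniteDimensional ℝ (α k i)] [∀ k i, MeasurableSpace (α k i)] [∀ k i, BorelSpace (α k i)]

/-- **THE SHAPE OF RECORD FROM CORES WITH TERM-DEPENDENT POLYMER FAMILIES** (kernel; row NE5's `termGaussianParamBi_termBi`, proof
VERBATIM, for `𝔊 k i X : BiCore P (dom k i) Op (β k i) (α k i)` — the polymer-family type `𝒴 k i` and its placement `dom k i` may
depend on the term): the term family `(k, i, o, h, X) ↦ (𝔊 k i X).termAt o h` satisfies `TermGaussianParamBi` with the cores' data
and letters, PROVIDED the operator letters hold on the open operator ball of every class centre (`hm`, `hN`, `hq` — rows NE2∕NE3's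
Gaussian data, displayed).  The representation clause holds by `rfl`. [folklore] -/
theorem termGaussianParamBi_termAt {W : Set (ℕ → ℝ)} {ctr : ℕ → (ℕ → ℝ) → C.BgB → Op × B13HistM P} {RHist R' : ℕ → ℝ}
    (𝔊 : ∀ k i, C.Dom → BiCore P (dom k i) Op (β k i) (α k i)) {m b N₀ : ℕ → ι → C.Dom → ℝ}
    (hm : ∀ k, ∀ g ∈ W, ∀ (U : C.BgB) (X : C.Dom), C.scale X = k → ∀ i, 0 < m k i X)
    (hN : ∀ k, ∀ g ∈ W, ∀ (U : C.BgB) (X : C.Dom), C.scale X = k → ∀ i,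
      (∀ o ∈ ball (ctr k g U).1 (R' k), AEStronglyMeasurable ((𝔊 k i X).N o) (𝔊 k i X).lam) ∧
      (∀ p, DifferentiableOn ℂ (fun o => (𝔊 k i X).N o p) (ball (ctr k g U).1 (R' k))) ∧
      (∀ o ∈ ball (ctr k g U).1 (R' k), ∀ p, ‖(𝔊 k i X).N o p‖ ≤ N₀ k i X))
    (hq : ∀ k, ∀ g ∈ W, ∀ (U : C.BgB) (X : C.Dom), C.scale X = k → ∀ i,
      (∀ o ∈ ball (ctr k g U).1 (R' k),
        AEStronglyMeasurable (Function.uncurry ((𝔊 k i X).q o)) ((𝔊 k i X).lam.prod volume)) ∧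
      (∀ p v, DifferentiableOn ℂ (fun o => (𝔊 k i X).q o p v) (ball (ctr k g U).1 (R' k))) ∧
      (∀ o ∈ ball (ctr k g U).1 (R' k), ∀ p v, m k i X * ‖v‖ ^ 2 - b k i X ≤ ((𝔊 k i X).q o p v).re)) :
    TermGaussianParamBi (fun k i o h X => (𝔊 k i X).termAt o h) W ctr RHist R' (fun k i X => (𝔊 k i X).lam)
      (fun k i X => (𝔊 k i X).w) (fun k i X => (𝔊 k i X).N) (fun k i X _ v => (𝔊 k i X).chi v)
      (fun k i X => (𝔊 k i X).readOut) (fun k i X => (𝔊 k i X).q) m b (fun k i X => (𝔊 k i X).wB) N₀ (fun _ _ _ => 1)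
      fun k i X => (𝔊 k i X).N₁ := by
  intro k g hg U X hX i
  obtain ⟨hNm, hNh, hNb⟩ := hN k g hg U X hX i
  obtain ⟨hqm, hqh, hqre⟩ := hq k g hg U X hX i
  haveI := (𝔊 k i X).finite
  exact ⟨(𝔊 k i X).finite, hm k g hg U X hX i, (𝔊 k i X).measW.aestronglyMeasurable, (𝔊 k i X).norm_w_le, hNm, hNh, hNb,
    ((𝔊 k i X).measurable_chi.comp measurable_snd).aestronglyMeasurable, fun _ v => (𝔊 k i X).norm_chi_le_one v,
    fun y => ((𝔊 k i X).measurable_readOut_apply y).aestronglyMeasurable, fun p v => (𝔊 k i X).norm_readOut_le p v,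
    (𝔊 k i X).N₁_nonneg, hqm, hqh, hqre, fun o _ h _ => rfl⟩

/-- **`TermHistExpLinear` FOR CORES WITH TERM-DEPENDENT POLYMER FAMILIES** (kernel; §1 ∘ row NE5's `termHistExpLinear_of_bi` BY NAME,
room `ROp k < R′ k`): the terms `(𝔊 k i X).termAt` are exp-linear in the table on the ball class `ballClass ctr ROp RHist`, with
reference measures `lam ⊗ volume`, densities `w(p)N(o,p)·(chi(v)e^{−q(o,p,v)})` and read-outs `readOut p v`. [folklore] -/
theorem termHistExpLinear_termAt {W : Set (ℕ → ℝ)} {ctr : ℕ → (ℕ → ℝ) → C.BgB → Op × B13HistM P} {ROp RHist R' : ℕ → ℝ}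
    (𝔊 : ∀ k i, C.Dom → BiCore P (dom k i) Op (β k i) (α k i)) {m b N₀ : ℕ → ι → C.Dom → ℝ} (hroom : ∀ k, ROp k < R' k)
    (hm : ∀ k, ∀ g ∈ W, ∀ (U : C.BgB) (X : C.Dom), C.scale X = k → ∀ i, 0 < m k i X)
    (hN : ∀ k, ∀ g ∈ W, ∀ (U : C.BgB) (X : C.Dom), C.scale X = k → ∀ i,
      (∀ o ∈ ball (ctr k g U).1 (R' k), AEStronglyMeasurable ((𝔊 k i X).N o) (𝔊 k i X).lam) ∧
      (∀ p, DifferentiableOn ℂ (fun o => (𝔊 k i X).N o p) (ball (ctr k g U).1 (R' k))) ∧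
      (∀ o ∈ ball (ctr k g U).1 (R' k), ∀ p, ‖(𝔊 k i X).N o p‖ ≤ N₀ k i X))
    (hq : ∀ k, ∀ g ∈ W, ∀ (U : C.BgB) (X : C.Dom), C.scale X = k → ∀ i,
      (∀ o ∈ ball (ctr k g U).1 (R' k),
        AEStronglyMeasurable (Function.uncurry ((𝔊 k i X).q o)) ((𝔊 k i X).lam.prod volume)) ∧
      (∀ p v, DifferentiableOn ℂ (fun o => (𝔊 k i X).q o p v) (ball (ctr k g U).1 (R' k))) ∧
      (∀ o ∈ ball (ctr k g U).1 (R' k), ∀ p v, m k i X * ‖v‖ ^ 2 - b k i X ≤ ((𝔊 k i X).q o p v).re)) :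
    TermHistExpLinear (ballClass ctr ROp RHist) (fun k i o h X => (𝔊 k i X).termAt o h) W
      (fun k i (_ : Op) X => ((𝔊 k i X).lam).prod (volume : Measure (α k i)))
      (fun k i o X z => (𝔊 k i X).w z.1 * (𝔊 k i X).N o z.1 * ((𝔊 k i X).chi z.2 * cexp (-(𝔊 k i X).q o z.1 z.2)))
      fun k i _ X z => (𝔊 k i X).readOut z.1 z.2 :=
  termHistExpLinear_of_bi (T := fun k i o h X => (𝔊 k i X).termAt o h) (F₀ := fun k i X _ v => (𝔊 k i X).chi v) hroom
    (termGaussianParamBi_termAt 𝔊 hm hN hq)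

/-! ## §2 THE ATTACHED-PART END ALONG THE LINEAR TABLE PENCIL FOR SUCH FAMILIES, (B3) AS N0q's LETTER BUDGET -/

variable (D : LocDomainSys) {Cube : Type} [DecidableEq Cube] (G : Geometry D Cube)

open Classical in
/-- **THE ATTACHED PART OF THE DRESSED SMALL-FIELD OUTPUT BUILT FROM CORES WITH TERM-DEPENDENT POLYMER FAMILIES, ALONG `h₀ + s • w`,
(B3) AS A LETTER BUDGET** (kernel; N0p §3's `attachedPart_locE_le_of_expLinear` ONCE BY NAME with `hexp := termHistExpLinear_termAt`,
the pencil data by N0p's `pencil_mem_ballClass` ∕ `norm_pencil_le`, the read-out bounds by the cores' `N₁`, and `hL3` from N0q's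
letter budget **`hM3`** through N0q §1's `norm_integral_coreDensity_le` termwise — N0q's `attachedPart_locE_le_of_cores_pencil_mass`
for term-dependent `dom k i`).  Binders (all displayed): `hroom`; `hm`∕`hN`∕`hq`; `hO`∕`hH`; `hscale`; `hact`; `G`; the clauses;
`hM3`; `hϱ`∕`hϱA`.  Conclusion: `‖E[act 1](X₀) − E[act 0](X₀)‖ ≤ 4·(e ν c₁ K₀²)·A₁·e^{−r₁ d(X₀)}`. [folklore] -/
theorem attachedPart_locE_le_of_coresAt_pencil_mass {W : Set (ℕ → ℝ)} {ctr : ℕ → (ℕ → ℝ) → C.BgB → Op × B13HistM P}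
    {ROp RHist R' : ℕ → ℝ} (𝔊 : ∀ k i, C.Dom → BiCore P (dom k i) Op (β k i) (α k i)) {mq bq N₀ : ℕ → ι → C.Dom → ℝ}
    (hroom : ∀ k, ROp k < R' k)
    (hm : ∀ k, ∀ g ∈ W, ∀ (U : C.BgB) (X : C.Dom), C.scale X = k → ∀ i, 0 < mq k i X)
    (hN : ∀ k, ∀ g ∈ W, ∀ (U : C.BgB) (X : C.Dom), C.scale X = k → ∀ i,
      (∀ o ∈ ball (ctr k g U).1 (R' k), AEStronglyMeasurable ((𝔊 k i X).N o) (𝔊 k i X).lam) ∧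
      (∀ p, DifferentiableOn ℂ (fun o => (𝔊 k i X).N o p) (ball (ctr k g U).1 (R' k))) ∧
      (∀ o ∈ ball (ctr k g U).1 (R' k), ∀ p, ‖(𝔊 k i X).N o p‖ ≤ N₀ k i X))
    (hq : ∀ k, ∀ g ∈ W, ∀ (U : C.BgB) (X : C.Dom), C.scale X = k → ∀ i,
      (∀ o ∈ ball (ctr k g U).1 (R' k),
        AEStronglyMeasurable (Function.uncurry ((𝔊 k i X).q o)) ((𝔊 k i X).lam.prod volume)) ∧
      (∀ p v, DifferentiableOn ℂ (fun o => (𝔊 k i X).q o p v) (ball (ctr k g U).1 (R' k))) ∧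
      (∀ o ∈ ball (ctr k g U).1 (R' k), ∀ p v, mq k i X * ‖v‖ ^ 2 - bq k i X ≤ ((𝔊 k i X).q o p v).re))
    {k : ℕ} {g : ℕ → ℝ} (hg : g ∈ W) {U : C.BgB} {o : Op} {h₀ w : B13HistM P} {ϱ : ℝ}
    (hO : ‖o - (ctr k g U).1‖ ≤ ROp k) (hH : ‖h₀ - (ctr k g U).2‖ + ϱ * ‖w‖ ≤ RHist k)
    {emb : D.Dom → C.Dom} (hscale : ∀ Z, C.scale (emb Z) = k) {terms : D.Dom → Finset ι} {act : ℂ → D.Dom → ℂ}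
    (hact : ∀ s ∈ ball (0 : ℂ) ϱ, ∀ Z, act s Z = ∑ i ∈ terms Z, (𝔊 k i (emb Z)).termAt o (h₀ + s • w))
    {A₀ A₁ R r₁ b₅ : ℝ} {X₀ : D.Dom} (hA₀ : 0 ≤ A₀) (hA₁ : 0 ≤ A₁) (hr₁ : 0 ≤ r₁) (hb : r₁ * 5 ≤ b₅)
    (hrate : r₁ + 2 * G.κ₀ + 2 ≤ R) (hsmall : (A₀ + ϱ * A₁) * Real.exp (b₅ + 1) * G.K₀ * G.ν * G.c₁ ≤ 1)
    (hM3 : ∀ Z, G.cubes Z ⊆ G.cubes X₀ →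
      ∑ i ∈ terms Z, (𝔊 k i (emb Z)).lam.real univ * ((𝔊 k i (emb Z)).wB * N₀ k i (emb Z) *
          Real.exp (bq k i (emb Z))) * (Real.pi / (mq k i (emb Z) / 2)) ^ (Module.finrank ℝ (α k i) / 2 : ℝ) *
        Real.exp ((𝔊 k i (emb Z)).N₁ * (‖h₀‖ + ϱ * ‖w‖)) ≤ (A₀ + ϱ * A₁) * Real.exp (-(R * D.dj Z)))
    (hϱ : 2 ≤ ϱ) (hϱA : A₀ ≤ ϱ * A₁) :
    ‖locE G.ι G.cubes (act 1) (G.cubes X₀) - locE G.ι G.cubes (act 0) (G.cubes X₀)‖ ≤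
      4 * (Real.exp 1 * G.ν * G.c₁ * G.K₀ ^ 2) * A₁ * Real.exp (-(r₁ * D.dj X₀)) := by
  have ho : o ∈ ball (ctr k g U).1 (R' k) := mem_ball.2 (by rw [dist_eq_norm]; exact lt_of_le_of_lt hO (hroom k))
  refine attachedPart_locE_le_of_expLinear D G (termHistExpLinear_termAt 𝔊 hroom hm hN hq) hg (hc := fun s => h₀ + s • w)
    ((differentiable_const h₀).add (differentiable_id.smul_const w)).differentiableOn
    (fun _ hs => pencil_mem_ballClass hO hH hs) (fun _ hs => norm_pencil_le hs) hscale hact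
    (fun Z i => (𝔊 k i (emb Z)).N₁_nonneg)
    (fun Z i _ => Filter.Eventually.of_forall fun z => (𝔊 k i (emb Z)).norm_readOut_le z.1 z.2)
    hA₀ hA₁ hr₁ hb hrate hsmall (fun Z hZ => le_trans ?_ (hM3 Z hZ)) hϱ hϱA
  refine Finset.sum_le_sum fun i _ => mul_le_mul_of_nonneg_right ?_ (Real.exp_pos _).le
  simpa only [one_mul] using norm_integral_coreDensity_le (𝔊 k i (emb Z)) (hm k g hg U (emb Z) (hscale Z) i)
    (hN k g hg U (emb Z) (hscale Z) i).2.2 (hq k g hg U (emb Z) (hscale Z) i).2.2 ho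

open Classical in
/-- **THE μ-PART (LINEAR SOURCE PENCIL `h₀ + s • v`, `‖s‖ < μ₁`) FOR CORES WITH TERM-DEPENDENT POLYMER FAMILIES, (B3) AS A LETTER
BUDGET** (kernel; N0p §3's `muPart_locE_le_of_expLinear` ONCE BY NAME with `hexp := termHistExpLinear_termAt`, pencil data by
`pencil_mem_ballClass` ∕ `norm_pencil_le` at radius `μ₁`, read-out bounds by `N₁`, `hL3` at the constant `A` from the letter budget
`hM3` via N0q §1 termwise).  For `0 < μ₀ < μ₁`, `‖sμ‖ ≤ μ₀`:
`‖E[act sμ](X₀) − E[act 0](X₀)‖ ≤ (e ν c₁ K₀²·A·e^{−r₁ d(X₀)})·μ₀∕(μ₁ − μ₀)`. [folklore] -/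
theorem muPart_locE_le_of_coresAt_pencil_mass {W : Set (ℕ → ℝ)} {ctr : ℕ → (ℕ → ℝ) → C.BgB → Op × B13HistM P}
    {ROp RHist R' : ℕ → ℝ} (𝔊 : ∀ k i, C.Dom → BiCore P (dom k i) Op (β k i) (α k i)) {mq bq N₀ : ℕ → ι → C.Dom → ℝ}
    (hroom : ∀ k, ROp k < R' k)
    (hm : ∀ k, ∀ g ∈ W, ∀ (U : C.BgB) (X : C.Dom), C.scale X = k → ∀ i, 0 < mq k i X)
    (hN : ∀ k, ∀ g ∈ W, ∀ (U : C.BgB) (X : C.Dom), C.scale X = k → ∀ i,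
      (∀ o ∈ ball (ctr k g U).1 (R' k), AEStronglyMeasurable ((𝔊 k i X).N o) (𝔊 k i X).lam) ∧
      (∀ p, DifferentiableOn ℂ (fun o => (𝔊 k i X).N o p) (ball (ctr k g U).1 (R' k))) ∧
      (∀ o ∈ ball (ctr k g U).1 (R' k), ∀ p, ‖(𝔊 k i X).N o p‖ ≤ N₀ k i X))
    (hq : ∀ k, ∀ g ∈ W, ∀ (U : C.BgB) (X : C.Dom), C.scale X = k → ∀ i,
      (∀ o ∈ ball (ctr k g U).1 (R' k),
        AEStronglyMeasurable (Function.uncurry ((𝔊 k i X).q o)) ((𝔊 k i X).lam.prod volume)) ∧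
      (∀ p v, DifferentiableOn ℂ (fun o => (𝔊 k i X).q o p v) (ball (ctr k g U).1 (R' k))) ∧
      (∀ o ∈ ball (ctr k g U).1 (R' k), ∀ p v, mq k i X * ‖v‖ ^ 2 - bq k i X ≤ ((𝔊 k i X).q o p v).re))
    {k : ℕ} {g : ℕ → ℝ} (hg : g ∈ W) {U : C.BgB} {o : Op} {h₀ v : B13HistM P} {μ₁ : ℝ}
    (hO : ‖o - (ctr k g U).1‖ ≤ ROp k) (hH : ‖h₀ - (ctr k g U).2‖ + μ₁ * ‖v‖ ≤ RHist k)
    {emb : D.Dom → C.Dom} (hscale : ∀ Z, C.scale (emb Z) = k) {terms : D.Dom → Finset ι} {act : ℂ → D.Dom → ℂ}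
    (hact : ∀ s ∈ ball (0 : ℂ) μ₁, ∀ Z, act s Z = ∑ i ∈ terms Z, (𝔊 k i (emb Z)).termAt o (h₀ + s • v))
    {A R r₁ b₅ μ₀ : ℝ} {X₀ : D.Dom} {sμ : ℂ} (hA : 0 ≤ A) (hr₁ : 0 ≤ r₁) (hb : r₁ * 5 ≤ b₅)
    (hrate : r₁ + 2 * G.κ₀ + 2 ≤ R) (hsmall : A * Real.exp (b₅ + 1) * G.K₀ * G.ν * G.c₁ ≤ 1)
    (hM3 : ∀ Z, G.cubes Z ⊆ G.cubes X₀ →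
      ∑ i ∈ terms Z, (𝔊 k i (emb Z)).lam.real univ * ((𝔊 k i (emb Z)).wB * N₀ k i (emb Z) *
          Real.exp (bq k i (emb Z))) * (Real.pi / (mq k i (emb Z) / 2)) ^ (Module.finrank ℝ (α k i) / 2 : ℝ) *
        Real.exp ((𝔊 k i (emb Z)).N₁ * (‖h₀‖ + μ₁ * ‖v‖)) ≤ A * Real.exp (-(R * D.dj Z)))
    (h0 : 0 < μ₀) (h01 : μ₀ < μ₁) (hμ : ‖sμ‖ ≤ μ₀) :
    ‖locE G.ι G.cubes (act sμ) (G.cubes X₀) - locE G.ι G.cubes (act 0) (G.cubes X₀)‖ ≤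
      Real.exp 1 * G.ν * G.c₁ * G.K₀ ^ 2 * A * Real.exp (-(r₁ * D.dj X₀)) * (μ₀ / (μ₁ - μ₀)) := by
  have ho : o ∈ ball (ctr k g U).1 (R' k) := mem_ball.2 (by rw [dist_eq_norm]; exact lt_of_le_of_lt hO (hroom k))
  refine muPart_locE_le_of_expLinear D G (termHistExpLinear_termAt 𝔊 hroom hm hN hq) hg (hc := fun s => h₀ + s • v)
    ((differentiable_const h₀).add (differentiable_id.smul_const v)).differentiableOn
    (fun _ hs => pencil_mem_ballClass hO hH hs) (fun _ hs => norm_pencil_le hs) hscale hact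
    (fun Z i => (𝔊 k i (emb Z)).N₁_nonneg)
    (fun Z i _ => Filter.Eventually.of_forall fun z => (𝔊 k i (emb Z)).norm_readOut_le z.1 z.2)
    hA hr₁ hb hrate hsmall (fun Z hZ => le_trans ?_ (hM3 Z hZ)) h0 h01 hμ
  refine Finset.sum_le_sum fun i _ => mul_le_mul_of_nonneg_right ?_ (Real.exp_pos _).le
  simpa only [one_mul] using norm_integral_coreDensity_le (𝔊 k i (emb Z)) (hm k g hg U (emb Z) (hscale Z) i)
    (hN k g hg U (emb Z) (hscale Z) i).2.2 (hq k g hg U (emb Z) (hscale Z) i).2.2 ho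

end Dep

/-! ## §3 AT THE SUBSTRATE'S LETTERS: the activity slot of record `actOfLetters ℓ` — `hact` BY `rfl`, no longer a binder -/

section Slot

variable {C : Carriers} (P : MeasPotFrame C) (Op : Type*) [NormedAddCommGroup Op] [NormedSpace ℂ Op] {Pol J : Type*}
  (𝒴 : Pol → J → Type) [∀ Z j, Fintype (𝒴 Z j)] (dom : ∀ Z j, 𝒴 Z j → C.Dom)
  (Jc : Pol → J → Type) [∀ Z j, Fintype (Jc Z j)]
  (V : Pol → J → Type) [∀ Z j, NormedAddCommGroup (V Z j)] [∀ Z j, InnerProductSpace ℝ (V Z j)]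
  [∀ Z j, MeasurableSpace (V Z j)] [∀ Z j, BorelSpace (V Z j)] [∀ Z j, FiniteDimensional ℝ (V Z j)]
variable (D : LocDomainSys) {Cube : Type} [DecidableEq Cube] (G : Geometry D Cube)

open Classical in
/-- **THE ATTACHED PART OF THE DRESSED SMALL-FIELD OUTPUT OF THE SUBSTRATE'S SLOT ACTIVITIES** (kernel; §2 at the term index
`Pol × J`, `𝔊 k p X := coreOf ℓ p.1 p.2`, and the dressed `locE`-activity of the geometry's polymer `Z` :=
`Σ_{p ∈ terms Z} actOfLetters ℓ p.1 p.2 o (h₀ + s • w)` — `hact` BY `rfl` (`actOfLetters_apply`); at `s = 1`∕`s = 0` the tables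
are `h₀ + w` ∕ `h₀`).  Binders, all DISPLAYED: the room `hroom`; the operator conditions of the substrate's SUPPLIED Gaussian
letters `(ℓ Z j).N`, `(ℓ Z j).q` on the open operator ball of the class centres (`hm`∕`hN`∕`hq`; = row NE5's factor-letter blocks,
dischargeable into p3's `SubstrateGaussianLettersBall` lemmas as in `B13AssemblyCoresEndSubstrateLetters` — not done here); the
class radii `hO`∕`hH` (the dressed table `h₀ + s•w` stays in the history ball); **(B1b)'s residue**: `terms : D.Dom → Finset (Pol ×
J)` and `emb`∕`hscale` — which substrate factors make up the `locE` polymer `Z`, placed at which step-`k` carrier domain; geometry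
`G`; clauses `hrate`∕`hsmall`, `5r₁ ≤ b₅`; (B3) as N0q's LETTER budget `hM3` on the substrate's cores (parameter volume
`(coreOf ℓ Z j).lam.real univ`, weight letter `(coreOf ℓ Z j).wB`, read-out letter `(coreOf ℓ Z j).N₁`, Gaussian letters
`N₀`∕`mq`∕`bq`, flat dimension `finrank (V Z j)`); N0m's `hϱ`∕`hϱA`.  Conclusion: `‖E[Σ actOfLetters … (h₀ + w)](X₀) −
E[Σ actOfLetters … h₀](X₀)‖ ≤ 4·(e ν c₁ K₀²)·A₁·e^{−r₁ d(X₀)}`. [folklore] -/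
theorem attachedPart_locE_le_of_actOfLetters {W : Set (ℕ → ℝ)} {ctr : ℕ → (ℕ → ℝ) → C.BgB → Op × B13HistM P}
    {ROp RHist R' : ℕ → ℝ} (ℓ : ∀ Z j, CoreLetters P Op 𝒴 dom Jc V Z j) {mq bq N₀ : ℕ → Pol × J → C.Dom → ℝ}
    (hroom : ∀ k, ROp k < R' k)
    (hm : ∀ k, ∀ g ∈ W, ∀ (U : C.BgB) (X : C.Dom), C.scale X = k → ∀ p, 0 < mq k p X)
    (hN : ∀ k, ∀ g ∈ W, ∀ (U : C.BgB) (X : C.Dom), C.scale X = k → ∀ p : Pol × J,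
      (∀ o ∈ ball (ctr k g U).1 (R' k),
        AEStronglyMeasurable ((ℓ p.1 p.2).N o) (coreOf P Op 𝒴 dom Jc V ℓ p.1 p.2).lam) ∧
      (∀ a, DifferentiableOn ℂ (fun o => (ℓ p.1 p.2).N o a) (ball (ctr k g U).1 (R' k))) ∧
      (∀ o ∈ ball (ctr k g U).1 (R' k), ∀ a, ‖(ℓ p.1 p.2).N o a‖ ≤ N₀ k p X))
    (hq : ∀ k, ∀ g ∈ W, ∀ (U : C.BgB) (X : C.Dom), C.scale X = k → ∀ p : Pol × J,
      (∀ o ∈ ball (ctr k g U).1 (R' k),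
        AEStronglyMeasurable (Function.uncurry ((ℓ p.1 p.2).q o))
          ((coreOf P Op 𝒴 dom Jc V ℓ p.1 p.2).lam.prod volume)) ∧
      (∀ a v, DifferentiableOn ℂ (fun o => (ℓ p.1 p.2).q o a v) (ball (ctr k g U).1 (R' k))) ∧
      (∀ o ∈ ball (ctr k g U).1 (R' k), ∀ a v, mq k p X * ‖v‖ ^ 2 - bq k p X ≤ ((ℓ p.1 p.2).q o a v).re))
    {k : ℕ} {g : ℕ → ℝ} (hg : g ∈ W) {U : C.BgB} {o : Op} {h₀ w : B13HistM P} {ϱ : ℝ}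
    (hO : ‖o - (ctr k g U).1‖ ≤ ROp k) (hH : ‖h₀ - (ctr k g U).2‖ + ϱ * ‖w‖ ≤ RHist k)
    {emb : D.Dom → C.Dom} (hscale : ∀ Z, C.scale (emb Z) = k) (terms : D.Dom → Finset (Pol × J))
    {A₀ A₁ R r₁ b₅ : ℝ} {X₀ : D.Dom} (hA₀ : 0 ≤ A₀) (hA₁ : 0 ≤ A₁) (hr₁ : 0 ≤ r₁) (hb : r₁ * 5 ≤ b₅)
    (hrate : r₁ + 2 * G.κ₀ + 2 ≤ R) (hsmall : (A₀ + ϱ * A₁) * Real.exp (b₅ + 1) * G.K₀ * G.ν * G.c₁ ≤ 1)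
    (hM3 : ∀ Z, G.cubes Z ⊆ G.cubes X₀ →
      ∑ p ∈ terms Z, (coreOf P Op 𝒴 dom Jc V ℓ p.1 p.2).lam.real univ *
          ((coreOf P Op 𝒴 dom Jc V ℓ p.1 p.2).wB * N₀ k p (emb Z) * Real.exp (bq k p (emb Z))) *
          (Real.pi / (mq k p (emb Z) / 2)) ^ (Module.finrank ℝ (V p.1 p.2) / 2 : ℝ) *
        Real.exp ((coreOf P Op 𝒴 dom Jc V ℓ p.1 p.2).N₁ * (‖h₀‖ + ϱ * ‖w‖)) ≤ (A₀ + ϱ * A₁) * Real.exp (-(R * D.dj Z)))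
    (hϱ : 2 ≤ ϱ) (hϱA : A₀ ≤ ϱ * A₁) :
    ‖locE G.ι G.cubes (fun Z => ∑ p ∈ terms Z, actOfLetters P Op 𝒴 dom Jc V ℓ p.1 p.2 o (h₀ + w)) (G.cubes X₀) -
        locE G.ι G.cubes (fun Z => ∑ p ∈ terms Z, actOfLetters P Op 𝒴 dom Jc V ℓ p.1 p.2 o h₀) (G.cubes X₀)‖ ≤
      4 * (Real.exp 1 * G.ν * G.c₁ * G.K₀ ^ 2) * A₁ * Real.exp (-(r₁ * D.dj X₀)) := by
  have h := attachedPart_locE_le_of_coresAt_pencil_mass D G (ι := Pol × J)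
    (fun (_ : ℕ) (p : Pol × J) (_ : C.Dom) => coreOf P Op 𝒴 dom Jc V ℓ p.1 p.2) hroom hm hN hq hg hO hH hscale
    (terms := terms) (act := fun s Z => ∑ p ∈ terms Z, actOfLetters P Op 𝒴 dom Jc V ℓ p.1 p.2 o (h₀ + s • w))
    (fun _ _ _ => rfl) hA₀ hA₁ hr₁ hb hrate hsmall hM3 hϱ hϱA
  simpa only [one_smul, zero_smul, add_zero] using h

open Classical in
/-- **THE μ-PART OF THE DRESSED SMALL-FIELD OUTPUT OF THE SUBSTRATE'S SLOT ACTIVITIES** (kernel; §2's μ-part END at the term index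
`Pol × J`, `𝔊 k p X := coreOf ℓ p.1 p.2`, SOURCE pencil `h₀ + s • v` in the table — the observable's table contribution `v` scaled by
the source `s`, `‖s‖ < μ₁` (MAP §O1 D-5′: the observable enters through the table); `hact` BY `rfl`).  For `0 < μ₀ < μ₁` and a
source `‖sμ‖ ≤ μ₀`: `‖E[Σ actOfLetters … o (h₀ + sμ • v)](X₀) − E[Σ actOfLetters … o h₀](X₀)‖ ≤ (e ν c₁ K₀²·A·e^{−r₁ d(X₀)})·
μ₀∕(μ₁ − μ₀)`, binders as in `attachedPart_locE_le_of_actOfLetters` with the (2.38)-letter budget at the constant `A` and the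
class radius `hH` at `μ₁`. [folklore] -/
theorem muPart_locE_le_of_actOfLetters {W : Set (ℕ → ℝ)} {ctr : ℕ → (ℕ → ℝ) → C.BgB → Op × B13HistM P}
    {ROp RHist R' : ℕ → ℝ} (ℓ : ∀ Z j, CoreLetters P Op 𝒴 dom Jc V Z j) {mq bq N₀ : ℕ → Pol × J → C.Dom → ℝ}
    (hroom : ∀ k, ROp k < R' k)
    (hm : ∀ k, ∀ g ∈ W, ∀ (U : C.BgB) (X : C.Dom), C.scale X = k → ∀ p, 0 < mq k p X)
    (hN : ∀ k, ∀ g ∈ W, ∀ (U : C.BgB) (X : C.Dom), C.scale X = k → ∀ p : Pol × J,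
      (∀ o ∈ ball (ctr k g U).1 (R' k),
        AEStronglyMeasurable ((ℓ p.1 p.2).N o) (coreOf P Op 𝒴 dom Jc V ℓ p.1 p.2).lam) ∧
      (∀ a, DifferentiableOn ℂ (fun o => (ℓ p.1 p.2).N o a) (ball (ctr k g U).1 (R' k))) ∧
      (∀ o ∈ ball (ctr k g U).1 (R' k), ∀ a, ‖(ℓ p.1 p.2).N o a‖ ≤ N₀ k p X))
    (hq : ∀ k, ∀ g ∈ W, ∀ (U : C.BgB) (X : C.Dom), C.scale X = k → ∀ p : Pol × J,
      (∀ o ∈ ball (ctr k g U).1 (R' k),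
        AEStronglyMeasurable (Function.uncurry ((ℓ p.1 p.2).q o))
          ((coreOf P Op 𝒴 dom Jc V ℓ p.1 p.2).lam.prod volume)) ∧
      (∀ a v, DifferentiableOn ℂ (fun o => (ℓ p.1 p.2).q o a v) (ball (ctr k g U).1 (R' k))) ∧
      (∀ o ∈ ball (ctr k g U).1 (R' k), ∀ a v, mq k p X * ‖v‖ ^ 2 - bq k p X ≤ ((ℓ p.1 p.2).q o a v).re))
    {k : ℕ} {g : ℕ → ℝ} (hg : g ∈ W) {U : C.BgB} {o : Op} {h₀ v : B13HistM P} {μ₁ : ℝ}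
    (hO : ‖o - (ctr k g U).1‖ ≤ ROp k) (hH : ‖h₀ - (ctr k g U).2‖ + μ₁ * ‖v‖ ≤ RHist k)
    {emb : D.Dom → C.Dom} (hscale : ∀ Z, C.scale (emb Z) = k) (terms : D.Dom → Finset (Pol × J))
    {A R r₁ b₅ μ₀ : ℝ} {X₀ : D.Dom} {sμ : ℂ} (hA : 0 ≤ A) (hr₁ : 0 ≤ r₁) (hb : r₁ * 5 ≤ b₅)
    (hrate : r₁ + 2 * G.κ₀ + 2 ≤ R) (hsmall : A * Real.exp (b₅ + 1) * G.K₀ * G.ν * G.c₁ ≤ 1)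
    (hM3 : ∀ Z, G.cubes Z ⊆ G.cubes X₀ →
      ∑ p ∈ terms Z, (coreOf P Op 𝒴 dom Jc V ℓ p.1 p.2).lam.real univ *
          ((coreOf P Op 𝒴 dom Jc V ℓ p.1 p.2).wB * N₀ k p (emb Z) * Real.exp (bq k p (emb Z))) *
          (Real.pi / (mq k p (emb Z) / 2)) ^ (Module.finrank ℝ (V p.1 p.2) / 2 : ℝ) *
        Real.exp ((coreOf P Op 𝒴 dom Jc V ℓ p.1 p.2).N₁ * (‖h₀‖ + μ₁ * ‖v‖)) ≤ A * Real.exp (-(R * D.dj Z)))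
    (h0 : 0 < μ₀) (h01 : μ₀ < μ₁) (hμ : ‖sμ‖ ≤ μ₀) :
    ‖locE G.ι G.cubes (fun Z => ∑ p ∈ terms Z, actOfLetters P Op 𝒴 dom Jc V ℓ p.1 p.2 o (h₀ + sμ • v)) (G.cubes X₀) -
        locE G.ι G.cubes (fun Z => ∑ p ∈ terms Z, actOfLetters P Op 𝒴 dom Jc V ℓ p.1 p.2 o h₀) (G.cubes X₀)‖ ≤
      Real.exp 1 * G.ν * G.c₁ * G.K₀ ^ 2 * A * Real.exp (-(r₁ * D.dj X₀)) * (μ₀ / (μ₁ - μ₀)) := by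
  have h := muPart_locE_le_of_coresAt_pencil_mass D G (ι := Pol × J)
    (fun (_ : ℕ) (p : Pol × J) (_ : C.Dom) => coreOf P Op 𝒴 dom Jc V ℓ p.1 p.2) hroom hm hN hq hg hO hH hscale
    (terms := terms) (act := fun s Z => ∑ p ∈ terms Z, actOfLetters P Op 𝒴 dom Jc V ℓ p.1 p.2 o (h₀ + s • v))
    (fun _ _ _ => rfl) hA hr₁ hb hrate hsmall hM3 h0 h01 hμ
  simpa only [zero_smul, add_zero] using h

end Slot

end Summit.QuantumFields.BalabanUV.T4Continuum.NE1p.DressedSmallFieldOnCoresSlot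

end
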